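import Summits.CriticalPhenomena.PercolationContinuityZ3.Theorems.SahiMasterFamilyUCBernsteinNested

/-!
# The ROOT-SUMMED block expansion of the edge polynomial, the typed criterion (C̄) and the two-theorem skeleton of
# conjecture (B): (C̄) at every two-sided restriction + (B♮) at every one-sided restriction ⇒ (B), every order

Unit `prim-masterthm-p4` (gen 24; crux anchor stmt-CriticalPhenomena-4575, helper work; memo
`run/shared/lean/prim/prim-masterthm/prim-masterthm-p4/P4-GEN24-REPORT.md` §1–§2).  Companion of `…BernsteinPos` (`BPos`, `mix`, `comap`,
the block expansion `Φ(β) = W(β) + Σ_{B ∋ last} (|B|−1)!·(1−β_B)·(−κ_B)` at the last index for every real `β`), `…UCBernsteinNested`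
(`bpos_W'`, `exists_emb_coRest'`: `−κ_B` is the edge polynomial of the pair pulled back to `univ ∖ B`) and `…UCBernsteinRootable`
(conjecture (B) for rootable pairs).

SETTING (memos P4-GEN22/23-REPORT).  `T = Fin (n+1)`, `𝒰, 𝒱` union-closed families of subsets of `T`, the EDGE POLYNOMIAL
`P_T(w) = Φ_{n+1}(w·1_𝒰 + (1−w)·1_𝒱)` (`phiSet ∘ mix`); conjecture (B) for the pair = `BPos (n+1) P_T` (all degree-`(n+1)` Bernstein
coefficients `≥ 0`); its hereditary form (B♮): `P_T` is Bernstein-positive whenever `T ∈ 𝒰 ∪ 𝒱`.  Rooting the block expansion at `z`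
(relabel by the transposition `(z last)`, `rooted z`) and SUMMING OVER ALL ROOTS `z ∈ T` gives, for a pair with `T ∈ 𝒰 ∩ 𝒱` (the top
block then carries the defect factor `1 − β_T = 0`),
  `(n+1)·P_T = Σ_z W^{(z)} + Σ_z Σ_{B ∋ z, B ≠ T} (|B|−1)!·γ_B·P_{T∖B}`,  `γ_B = 1 − β_B ∈ {0, w, 1−w, 1}`,
the paper identity `k·P_T = M_T + Σ_{∅≠B⊊T} |B|!·γ_B·P_{T∖B}` (`M_T = Σ_z W^{(z)}`; each block `B` is counted once per root `z ∈ B`).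
Splitting the blocks by the TYPE of the complement `T ∖ B` — BAD (`T∖B` in neither family; then `P_{T∖B} ≤_B 0` by the sign law of
`…UCBernsteinUpper`) or GOOD (in at least one family) — the identity reads `(n+1)·P_T = cbarSlack + goodPart` (`sum_roots_identity`), and

  **(C̄) (`RootSummed.CBar n`, typed conjecture):  `cbarSlack 𝒰 𝒱 = Σ_z [ W^{(z)} + Σ_{B ∋ z, B ≠ T, T∖B bad} (|B|−1)!·γ_B·P_{T∖B} ]` is `BPos (n+1)`**
  for every pair of union-closed families containing `univ` — memo form `M_T ≥_B Σ_{bad Q ⊊ T} (k−|Q|)!·γ_{T∖Q}·N_Q`, equivalently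
  `k·P_T ≥_B Σ_{good Q ⊊ T} (k−|Q|)!·γ_{T∖Q}·P_Q` (P4-GEN23-REPORT §3(i): 0 failures on ≤ 5 points exhaustively, on ≈ 2·10⁹ sampled pairs on
  5 points, invariant pairs to 16 points, all structured families; the root-by-root criterion C1 and every rule naming one root are refuted).

**THEOREM (`bpos_mix_of_cbar_of_oneSided`, every order; the "THM A + THM B ⇒ (B)" skeleton of P4-GEN23-REPORT §3(j) in the kernel).**
Let `𝒰, 𝒱` be union-closed with `univ ∈ 𝒰 ∩ 𝒱`.  If (C̄) holds for every pulled-back pair `(comap e 𝒰, comap e 𝒱)` along an embedding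
`e : Fin (m+1) ↪ Fin (n+1)` whose top lies in BOTH pulled-back families (the two-sided restrictions, including the pair itself), and the edge
polynomial of every pulled-back pair whose top lies in EXACTLY ONE family is Bernstein-positive (hereditary (B♮) at one-sided restrictions),
then `P_T` is `BPos (n+1)`.  PROOF: strong induction on `n`; `(n+1)·P_T = cbarSlack + goodPart`; `cbarSlack` is the hypothesis at `e = id`;
each good block term is `(|B|−1)!·γ_B·P_{T∖B}` with `γ_B` `BPos 1` and `P_{T∖B}` the edge polynomial of the pair pulled back along the
complementary embedding composed with the root transposition — two-sided ⇒ induction (the hypotheses are inherited through `comap_comap`),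
one-sided ⇒ hypothesis; divide by `n+1`.  COROLLARY `bpos_mix_of_CBar_of_oneSided`: `(∀ m ≤ n, CBar m)` + hereditary one-sided (B♮) ⇒ (B)
for the pair.  So conjecture (B) for two families splits into the explicit criterion (C̄) at two-sided nodes (THEOREM A of the memo) and (B♮) at
one-sided nodes (THEOREM B), with no root choice anywhere.
HONEST FRAMING: an identity, a typed conjecture and a proved reduction; (C̄), (B), `UCHullNonneg k` (k ≥ 8), Sahi's `C_k` and the master theorem
remain OPEN.  Gen 24 also records (memo §2) that the CRUDE form of (C̄) with the ray bound `ray ≤_B w·(|S|−1)!` is FALSE from 7 points, that no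
designated-element rule makes (C̄) hold labelling by labelling (4 points), and an explicit Z-averaged one-sided companion criterion.  Axioms
standard. [this work]
-/

noncomputable section

open scoped Classical

namespace Summit.CriticalPhenomena.PercolationContinuityZ3.Theorems

namespace RootSummed

open Finset Function Equiv
open Literature.Combinatorics.Sahi2008
open Literature.Combinatorics.Sahi2008.CycleForm
open PrincipalCapBeta (phiSet realF realW)
open BernsteinPos UCBernsteinNested

variable {n : ℕ}

/-! ### Rooting a pair at `z`: relabel by the transposition `(z last)` -/

/-- Pull-backs compose (as in `…UCBernsteinRootable`, restated here to keep the import light). [this work] -/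
theorem comap_comap' {m l k : ℕ} (e : Fin l ↪ Fin m) (f : Fin m ↪ Fin k) (𝒰 : Finset (Finset (Fin k))) :
    comap e (comap f 𝒰) = comap (e.trans f) 𝒰 := by
  ext S
  rw [mem_comap, mem_comap, mem_comap, Finset.map_map]

/-- The family relabelled so that the root `z` becomes the last index. [this work] -/
def rooted (z : Fin (n + 1)) (𝒰 : Finset (Finset (Fin (n + 1)))) : Finset (Finset (Fin (n + 1))) :=
  comap (Equiv.swap z (Fin.last n)).toEmbedding 𝒰

/-- Rooting preserves membership of the top. [this work] -/
theorem univ_mem_rooted {z : Fin (n + 1)} {𝒰 : Finset (Finset (Fin (n + 1)))} (h : univ ∈ 𝒰) : univ ∈ rooted z 𝒰 := by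
  unfold rooted; rw [mem_comap, Finset.map_univ_equiv]; exact h

/-- Rooting preserves non-membership of the top. [this work] -/
theorem univ_mem_of_rooted {z : Fin (n + 1)} {𝒰 : Finset (Finset (Fin (n + 1)))} (h : univ ∈ rooted z 𝒰) : univ ∈ 𝒰 := by
  unfold rooted at h; rw [mem_comap, Finset.map_univ_equiv] at h; exact h

/-- Rooting preserves union-closure. [this work] -/
theorem rooted_unionClosed (z : Fin (n + 1)) {𝒰 : Finset (Finset (Fin (n + 1)))} (hU : ∀ A ∈ 𝒰, ∀ B ∈ 𝒰, A ∪ B ∈ 𝒰) :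
    ∀ A ∈ rooted z 𝒰, ∀ B ∈ rooted z 𝒰, A ∪ B ∈ rooted z 𝒰 :=
  comap_unionClosed _ 𝒰 hU

/-- The edge polynomial is invariant under rooting. [this work] -/
theorem phiSet_mix_rooted (z : Fin (n + 1)) (𝒰 𝒱 : Finset (Finset (Fin (n + 1)))) (w : ℝ) :
    phiSet (n + 1) (mix (rooted z 𝒰) (rooted z 𝒱) w) = phiSet (n + 1) (mix 𝒰 𝒱 w) :=
  phiSet_mix_comap_perm _ 𝒰 𝒱 w

/-! ### The block terms, split by the type of the complement -/

/-- The block term `(|B|−1)!·(1 − β_B)·(−κ_B)` of the block expansion at the last index (`−κ_B` = edge polynomial of the restriction to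
`univ ∖ B`, `UCBernsteinNested.exists_emb_coRest'`). [this work] -/
def blockTerm (𝒰 𝒱 : Finset (Finset (Fin (n + 1)))) (B : Finset (Fin (n + 1))) (w : ℝ) : ℝ :=
  ((B.card - 1).factorial : ℝ) * ((1 - mix 𝒰 𝒱 w B) * (-coRest (realW (mix 𝒰 𝒱 w)) realF B))

/-- The cap term `W(β) = Σ_{σ ∈ S_n} ∏_{c ∈ cyc σ} (1 − β_c)` at the last index (`= W^{(z)}` after rooting at `z`). [this work] -/
def capW (𝒰 𝒱 : Finset (Finset (Fin (n + 1)))) (w : ℝ) : ℝ :=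
  ∑ σ : Perm (Fin n), ∏ B ∈ orbits σ, (1 - mix 𝒰 𝒱 w (B.map Fin.castSuccEmb))

/-- Proper blocks through the last index whose complement is BAD (in neither family). [this work] -/
def badBlocks (𝒰 𝒱 : Finset (Finset (Fin (n + 1)))) : Finset (Finset (Fin (n + 1))) :=
  univ.filter fun B => Fin.last n ∈ B ∧ B ≠ univ ∧ (univ \ B ∉ 𝒰 ∧ univ \ B ∉ 𝒱)

/-- Proper blocks through the last index whose complement is GOOD (in at least one family). [this work] -/
def goodBlocks (𝒰 𝒱 : Finset (Finset (Fin (n + 1)))) : Finset (Finset (Fin (n + 1))) :=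
  univ.filter fun B => Fin.last n ∈ B ∧ B ≠ univ ∧ ¬(univ \ B ∉ 𝒰 ∧ univ \ B ∉ 𝒱)

/-- **The (C̄) slack**: `Σ_z [ W^{(z)} + Σ_{B ∋ z, B ≠ T, T∖B bad} (|B|−1)!·γ_B·P_{T∖B} ]` (memo: `M_T − Σ_{bad Q⊊T} (k−|Q|)!·γ_{T∖Q}·N_Q`).
[this work] -/
def cbarSlack (𝒰 𝒱 : Finset (Finset (Fin (n + 1)))) (w : ℝ) : ℝ :=
  ∑ z : Fin (n + 1), (capW (rooted z 𝒰) (rooted z 𝒱) w +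
    ∑ B ∈ badBlocks (rooted z 𝒰) (rooted z 𝒱), blockTerm (rooted z 𝒰) (rooted z 𝒱) B w)

/-- The good part `Σ_z Σ_{B ∋ z, B ≠ T, T∖B good} (|B|−1)!·γ_B·P_{T∖B}` (memo: `Σ_{good Q⊊T} (k−|Q|)!·γ_{T∖Q}·P_Q`). [this work] -/
def goodPart (𝒰 𝒱 : Finset (Finset (Fin (n + 1)))) (w : ℝ) : ℝ :=
  ∑ z : Fin (n + 1), ∑ B ∈ goodBlocks (rooted z 𝒰) (rooted z 𝒱), blockTerm (rooted z 𝒰) (rooted z 𝒱) B w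

/-! ### The root-summed identity -/

/-- At one root: for a pair containing `univ` in both families, the block expansion at the last index has no top term and splits into cap term,
bad blocks and good blocks. [this work] -/
theorem phiSet_mix_eq_cap_add_blocks (𝒰 𝒱 : Finset (Finset (Fin (n + 1)))) (hU : univ ∈ 𝒰) (hV : univ ∈ 𝒱) (w : ℝ) :
    phiSet (n + 1) (mix 𝒰 𝒱 w) =
      capW 𝒰 𝒱 w + (∑ B ∈ badBlocks 𝒰 𝒱, blockTerm 𝒰 𝒱 B w) + ∑ B ∈ goodBlocks 𝒰 𝒱, blockTerm 𝒰 𝒱 B w := by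
  rw [phiSet_eq_W_add_sum (mix 𝒰 𝒱 w)]
  unfold capW
  rw [add_assoc]
  congr 1
  -- the blocks through the last index: `univ` (zero term) + bad + good
  have hsplit : ∑ B ∈ univ.filter (fun B : Finset (Fin (n + 1)) => Fin.last n ∈ B), blockTerm 𝒰 𝒱 B w =
      ∑ B ∈ univ.filter (fun B : Finset (Fin (n + 1)) => Fin.last n ∈ B ∧ B ≠ univ), blockTerm 𝒰 𝒱 B w := by
    rw [← Finset.sum_filter_add_sum_filter_not (univ.filter fun B : Finset (Fin (n + 1)) => Fin.last n ∈ B)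
      (fun B => B = univ) (fun B => blockTerm 𝒰 𝒱 B w)]
    have h0 : ∑ B ∈ (univ.filter fun B : Finset (Fin (n + 1)) => Fin.last n ∈ B).filter (fun B => B = univ),
        blockTerm 𝒰 𝒱 B w = 0 := by
      refine sum_eq_zero fun B hB => ?_
      have hBu : B = univ := (mem_filter.1 hB).2
      unfold blockTerm mix
      rw [hBu, if_pos hU, if_pos hV]
      ring
    rw [h0, zero_add, Finset.filter_filter]
  have hsplit2 : ∑ B ∈ univ.filter (fun B : Finset (Fin (n + 1)) => Fin.last n ∈ B ∧ B ≠ univ), blockTerm 𝒰 𝒱 B w =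
      (∑ B ∈ badBlocks 𝒰 𝒱, blockTerm 𝒰 𝒱 B w) + ∑ B ∈ goodBlocks 𝒰 𝒱, blockTerm 𝒰 𝒱 B w := by
    rw [← Finset.sum_filter_add_sum_filter_not (univ.filter fun B : Finset (Fin (n + 1)) => Fin.last n ∈ B ∧ B ≠ univ)
      (fun B => univ \ B ∉ 𝒰 ∧ univ \ B ∉ 𝒱) (fun B => blockTerm 𝒰 𝒱 B w)]
    unfold badBlocks goodBlocks
    rw [Finset.filter_filter, Finset.filter_filter]
    congr 1
    · refine Finset.sum_congr ?_ fun _ _ => rfl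
      ext B; simp only [mem_filter, mem_univ, true_and, and_assoc]
    · refine Finset.sum_congr ?_ fun _ _ => rfl
      ext B; simp only [mem_filter, mem_univ, true_and, and_assoc]
  have e3 : ∑ B ∈ univ.filter (fun B : Finset (Fin (n + 1)) => Fin.last n ∈ B),
      ((B.card - 1).factorial : ℝ) * ((1 - mix 𝒰 𝒱 w B) * (-coRest (realW (mix 𝒰 𝒱 w)) realF B)) =
      ∑ B ∈ univ.filter (fun B : Finset (Fin (n + 1)) => Fin.last n ∈ B), blockTerm 𝒰 𝒱 B w := rfl
  rw [e3, hsplit, hsplit2]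

/-- **Root-summed identity** (paper: `k·P_T = M_T + Σ_{∅≠B⊊T} |B|!·γ_B·P_{T∖B}`): for union-closed or not, any pair with
`univ ∈ 𝒰 ∩ 𝒱`, `(n+1)·P_T(w) = cbarSlack 𝒰 𝒱 w + goodPart 𝒰 𝒱 w`. [this work] -/
theorem sum_roots_identity (𝒰 𝒱 : Finset (Finset (Fin (n + 1)))) (hU : univ ∈ 𝒰) (hV : univ ∈ 𝒱) (w : ℝ) :
    ((n : ℝ) + 1) * phiSet (n + 1) (mix 𝒰 𝒱 w) = cbarSlack 𝒰 𝒱 w + goodPart 𝒰 𝒱 w := by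
  have hsum : ∑ z : Fin (n + 1), phiSet (n + 1) (mix (rooted z 𝒰) (rooted z 𝒱) w) = ((n : ℝ) + 1) * phiSet (n + 1) (mix 𝒰 𝒱 w) := by
    rw [Finset.sum_congr rfl fun z _ => phiSet_mix_rooted z 𝒰 𝒱 w, Finset.sum_const, card_univ, Fintype.card_fin, nsmul_eq_mul]
    push_cast
    ring
  rw [← hsum]
  unfold cbarSlack goodPart
  rw [← Finset.sum_add_distrib]
  refine Finset.sum_congr rfl fun z _ => ?_
  rw [phiSet_mix_eq_cap_add_blocks _ _ (univ_mem_rooted hU) (univ_mem_rooted hV)]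

/-! ### The typed criterion (C̄) -/

/-- **CONJECTURE (C̄) at order `n+1`** (P4-GEN23-REPORT §3(i), P4-GEN24-REPORT §1): for every pair of union-closed families of subsets of
`Fin (n+1)` both containing `univ`, the root-summed cap terms dominate the bad block terms coefficientwise in the Bernstein basis:
`Σ_z W^{(z)} ≥_B Σ_{bad Q ⊊ T} (n+1−|Q|)!·γ_{T∖Q}·N_Q`.  Numerically: exhaustive on ≤ 5 points, ≈ 2·10⁹ sampled pairs on 5 points, random and
adversarial pairs on 6–7 points, Young-invariant pairs to 16 points, all structured families of the programme — 0 failures.  Together with (B♮) at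
one-sided restrictions it implies conjecture (B) for the pair (`bpos_mix_of_CBar_of_oneSided`); the slack of one pair is `cbarSlack`.  A conjecture-valued definition, never a fact.
[this work] [status: open; true on ≤ 5 points by exhaustive enumeration outside the kernel] -/
@[conjecture] def CBar (n : ℕ) : Prop :=
  ∀ 𝒰 𝒱 : Finset (Finset (Fin (n + 1))),
    (∀ A ∈ 𝒰, ∀ B ∈ 𝒰, A ∪ B ∈ 𝒰) → (∀ A ∈ 𝒱, ∀ B ∈ 𝒱, A ∪ B ∈ 𝒱) → univ ∈ 𝒰 → univ ∈ 𝒱 → BPos (n + 1) (cbarSlack 𝒰 𝒱)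

/-! ### The reduction: (C̄) at two-sided restrictions + (B♮) at one-sided restrictions ⇒ (B) -/

/-- Pull-back along the identity. [this work] -/
theorem comap_refl (𝒰 : Finset (Finset (Fin (n + 1)))) : comap (Equiv.refl (Fin (n + 1))).toEmbedding 𝒰 = 𝒰 := by
  ext S
  rw [mem_comap]
  have : S.map (Equiv.refl (Fin (n + 1))).toEmbedding = S := by
    ext x; simp
  rw [this]

/-- For a good block `B ∋ last` of a pair containing `univ` in both families, the restricted edge polynomial `−κ_B` is `BPos n`, given the
theorem one order down for two-sided pulled-back pairs and the hypothesis for one-sided ones. [this work] -/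
theorem bpos_negCoRest_of_good (𝒰 𝒱 : Finset (Finset (Fin (n + 1))))
    (htwo : ∀ (m : ℕ) (e : Fin (m + 1) ↪ Fin (n + 1)), m < n → univ ∈ comap e 𝒰 → univ ∈ comap e 𝒱 →
      BPos (m + 1) (fun w => phiSet (m + 1) (mix (comap e 𝒰) (comap e 𝒱) w)))
    (hone : ∀ (m : ℕ) (e : Fin (m + 1) ↪ Fin (n + 1)), ¬(univ ∈ comap e 𝒰 ↔ univ ∈ comap e 𝒱) →
      BPos (m + 1) (fun w => phiSet (m + 1) (mix (comap e 𝒰) (comap e 𝒱) w)))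
    {B : Finset (Fin (n + 1))} (hlB : Fin.last n ∈ B) (hBu : B ≠ univ) (hgood : ¬(univ \ B ∉ 𝒰 ∧ univ \ B ∉ 𝒱)) :
    BPos n (fun w => -coRest (realW (mix 𝒰 𝒱 w)) realF B) := by
  obtain ⟨m, e, he, hsurj, hc⟩ := exists_emb_coRest' hBu
  have hm : m < n := PhiVertex.lt_of_emb_ne_last e fun j hj => he j (by rw [hj]; exact hlB)
  have hrange : (univ : Finset (Fin (m + 1))).map e = univ \ B := map_univ_eq_sdiff e he hsurj
  have hmemU : univ ∈ comap e 𝒰 ↔ univ \ B ∈ 𝒰 := by rw [mem_comap, hrange]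
  have hmemV : univ ∈ comap e 𝒱 ↔ univ \ B ∈ 𝒱 := by rw [mem_comap, hrange]
  have key : BPos (m + 1) (fun w => phiSet (m + 1) (mix (comap e 𝒰) (comap e 𝒱) w)) := by
    by_cases hU : univ \ B ∈ 𝒰
    · by_cases hV : univ \ B ∈ 𝒱
      · exact htwo m e hm (hmemU.2 hU) (hmemV.2 hV)
      · exact hone m e fun h => hV (hmemV.1 (h.1 (hmemU.2 hU)))
    · by_cases hV : univ \ B ∈ 𝒱
      · exact hone m e fun h => hU (hmemU.1 (h.2 (hmemV.2 hV)))
      · exact absurd ⟨hU, hV⟩ hgood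
  refine (key.mono (by omega)).congr fun w => ?_
  rw [hc, mix_map, neg_neg]

/-- The good part is Bernstein-positive, given the theorem one order down for two-sided pulled-back pairs and the hypothesis for one-sided
ones (both stated for the ORIGINAL pair; rooting is absorbed by `comap_comap`). [this work] -/
theorem bpos_goodPart (𝒰 𝒱 : Finset (Finset (Fin (n + 1))))
    (htwo : ∀ (m : ℕ) (e : Fin (m + 1) ↪ Fin (n + 1)), m < n → univ ∈ comap e 𝒰 → univ ∈ comap e 𝒱 →
      BPos (m + 1) (fun w => phiSet (m + 1) (mix (comap e 𝒰) (comap e 𝒱) w)))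
    (hone : ∀ (m : ℕ) (e : Fin (m + 1) ↪ Fin (n + 1)), ¬(univ ∈ comap e 𝒰 ↔ univ ∈ comap e 𝒱) →
      BPos (m + 1) (fun w => phiSet (m + 1) (mix (comap e 𝒰) (comap e 𝒱) w))) :
    BPos (n + 1) (goodPart 𝒰 𝒱) := by
  unfold goodPart
  refine BPos.sum univ (fun z w => ∑ B ∈ goodBlocks (rooted z 𝒰) (rooted z 𝒱), blockTerm (rooted z 𝒰) (rooted z 𝒱) B w)
    fun z _ => ?_
  refine BPos.sum _ (fun B w => blockTerm (rooted z 𝒰) (rooted z 𝒱) B w) fun B hB => ?_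
  obtain ⟨hlB, hBu, hgood⟩ := (mem_filter.1 hB).2
  let σ : Perm (Fin (n + 1)) := Equiv.swap z (Fin.last n)
  -- hypotheses transported to the rooted pair
  have htwo' : ∀ (m : ℕ) (e : Fin (m + 1) ↪ Fin (n + 1)), m < n → univ ∈ comap e (rooted z 𝒰) → univ ∈ comap e (rooted z 𝒱) →
      BPos (m + 1) (fun w => phiSet (m + 1) (mix (comap e (rooted z 𝒰)) (comap e (rooted z 𝒱)) w)) := by
    intro m e hm h1 h2
    unfold rooted at h1 h2 ⊢
    rw [comap_comap'] at h1 h2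
    rw [comap_comap', comap_comap']
    exact htwo m _ hm h1 h2
  have hone' : ∀ (m : ℕ) (e : Fin (m + 1) ↪ Fin (n + 1)), ¬(univ ∈ comap e (rooted z 𝒰) ↔ univ ∈ comap e (rooted z 𝒱)) →
      BPos (m + 1) (fun w => phiSet (m + 1) (mix (comap e (rooted z 𝒰)) (comap e (rooted z 𝒱)) w)) := by
    intro m e h
    unfold rooted at h ⊢
    rw [comap_comap', comap_comap'] at h
    rw [comap_comap', comap_comap']
    exact hone m _ h
  have hsub := bpos_negCoRest_of_good (rooted z 𝒰) (rooted z 𝒱) htwo' hone' hlB hBu hgood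
  unfold blockTerm
  exact (((bpos_one_sub_mix' (rooted z 𝒰) (rooted z 𝒱) B).mul hsub).smul (Nat.cast_nonneg _)).mono (by omega)

/-- **THEOREM (the two-theorem skeleton of (B), every order).**  For union-closed `𝒰, 𝒱 ∋ univ` on `Fin (n+1)`: if the (C̄) slack of every
two-sided pulled-back pair (including the pair itself) is Bernstein-positive, and the edge polynomial of every one-sided pulled-back pair is
Bernstein-positive, then the edge polynomial of the pair is Bernstein-positive — conjecture (B) for the pair. [this work] -/
theorem bpos_mix_of_cbar_of_oneSided : ∀ (n : ℕ) (𝒰 𝒱 : Finset (Finset (Fin (n + 1)))),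
    (∀ A ∈ 𝒰, ∀ B ∈ 𝒰, A ∪ B ∈ 𝒰) → (∀ A ∈ 𝒱, ∀ B ∈ 𝒱, A ∪ B ∈ 𝒱) → univ ∈ 𝒰 → univ ∈ 𝒱 →
    (∀ (m : ℕ) (e : Fin (m + 1) ↪ Fin (n + 1)), univ ∈ comap e 𝒰 → univ ∈ comap e 𝒱 → BPos (m + 1) (cbarSlack (comap e 𝒰) (comap e 𝒱))) →
    (∀ (m : ℕ) (e : Fin (m + 1) ↪ Fin (n + 1)), ¬(univ ∈ comap e 𝒰 ↔ univ ∈ comap e 𝒱) →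
      BPos (m + 1) (fun w => phiSet (m + 1) (mix (comap e 𝒰) (comap e 𝒱) w))) →
    BPos (n + 1) (fun w => phiSet (n + 1) (mix 𝒰 𝒱 w)) := by
  intro n
  induction n using Nat.strong_induction_on with
  | _ n ih =>
  intro 𝒰 𝒱 hUC hVC hU hV hC hS
  -- the theorem one order down for two-sided pulled-back pairs
  have htwo : ∀ (m : ℕ) (e : Fin (m + 1) ↪ Fin (n + 1)), m < n → univ ∈ comap e 𝒰 → univ ∈ comap e 𝒱 →
      BPos (m + 1) (fun w => phiSet (m + 1) (mix (comap e 𝒰) (comap e 𝒱) w)) := by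
    intro m e hm h1 h2
    refine ih m hm (comap e 𝒰) (comap e 𝒱) (comap_unionClosed e 𝒰 hUC) (comap_unionClosed e 𝒱 hVC) h1 h2 ?_ ?_
    · intro m' e' h1' h2'
      rw [comap_comap'] at h1' h2'
      rw [comap_comap', comap_comap']
      exact hC m' _ h1' h2'
    · intro m' e' h'
      rw [comap_comap', comap_comap'] at h'
      rw [comap_comap', comap_comap']
      exact hS m' _ h'
  have hslack : BPos (n + 1) (cbarSlack 𝒰 𝒱) := by
    have h := hC n (Equiv.refl (Fin (n + 1))).toEmbedding (by rw [comap_refl]; exact hU) (by rw [comap_refl]; exact hV)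
    rw [comap_refl, comap_refl] at h
    exact h
  have hgood := bpos_goodPart 𝒰 𝒱 htwo hS
  have hk : BPos (n + 1) (fun w => ((n : ℝ) + 1) * phiSet (n + 1) (mix 𝒰 𝒱 w)) :=
    (hslack.add hgood).congr fun w => (sum_roots_identity 𝒰 𝒱 hU hV w).symm
  have hpos : (0 : ℝ) ≤ 1 / ((n : ℝ) + 1) := by positivity
  refine (hk.smul hpos).congr fun w => ?_
  have hne : ((n : ℝ) + 1) ≠ 0 := by positivity
  field_simp

/-- **COROLLARY.**  `(∀ m ≤ n, CBar m)` together with hereditary (B♮) at the one-sided restrictions of a union-closed pair `𝒰, 𝒱 ∋ univ` on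
`Fin (n+1)` gives conjecture (B) for the pair: THEOREM A (= (C̄)) and THEOREM B (= one-sided (B♮)) of the memo imply (B). [this work] -/
theorem bpos_mix_of_CBar_of_oneSided (𝒰 𝒱 : Finset (Finset (Fin (n + 1))))
    (hUC : ∀ A ∈ 𝒰, ∀ B ∈ 𝒰, A ∪ B ∈ 𝒰) (hVC : ∀ A ∈ 𝒱, ∀ B ∈ 𝒱, A ∪ B ∈ 𝒱) (hU : univ ∈ 𝒰) (hV : univ ∈ 𝒱)
    (hC : ∀ m ≤ n, CBar m)
    (hS : ∀ (m : ℕ) (e : Fin (m + 1) ↪ Fin (n + 1)), ¬(univ ∈ comap e 𝒰 ↔ univ ∈ comap e 𝒱) →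
      BPos (m + 1) (fun w => phiSet (m + 1) (mix (comap e 𝒰) (comap e 𝒱) w))) :
    BPos (n + 1) (fun w => phiSet (n + 1) (mix 𝒰 𝒱 w)) := by
  refine bpos_mix_of_cbar_of_oneSided n 𝒰 𝒱 hUC hVC hU hV (fun m e h1 h2 => ?_) hS
  have hm : m ≤ n := by
    have h := Finset.card_le_card (Finset.subset_univ ((univ : Finset (Fin (m + 1))).map e))
    rw [card_map, card_univ, Fintype.card_fin, card_univ, Fintype.card_fin] at h
    omega
  exact hC m hm _ _ (comap_unionClosed e 𝒰 hUC) (comap_unionClosed e 𝒱 hVC) h1 h2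

/-- Pointwise form of the reduction: `(UC-hull)` on the edge `[1_𝒰, 1_𝒱]` under the same hypotheses. [this work] -/
theorem phiSet_mix_nonneg_of_CBar_of_oneSided (𝒰 𝒱 : Finset (Finset (Fin (n + 1))))
    (hUC : ∀ A ∈ 𝒰, ∀ B ∈ 𝒰, A ∪ B ∈ 𝒰) (hVC : ∀ A ∈ 𝒱, ∀ B ∈ 𝒱, A ∪ B ∈ 𝒱) (hU : univ ∈ 𝒰) (hV : univ ∈ 𝒱)
    (hC : ∀ m ≤ n, CBar m)
    (hS : ∀ (m : ℕ) (e : Fin (m + 1) ↪ Fin (n + 1)), ¬(univ ∈ comap e 𝒰 ↔ univ ∈ comap e 𝒱) →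
      BPos (m + 1) (fun w => phiSet (m + 1) (mix (comap e 𝒰) (comap e 𝒱) w)))
    {w : ℝ} (hw0 : 0 ≤ w) (hw1 : w ≤ 1) : 0 ≤ phiSet (n + 1) (mix 𝒰 𝒱 w) :=
  (bpos_mix_of_CBar_of_oneSided 𝒰 𝒱 hUC hVC hU hV hC hS).nonneg hw0 hw1

end RootSummed

end Summit.CriticalPhenomena.PercolationContinuityZ3.Theorems
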